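import Summits.NavierStokesRegularity.NavierStokesRegularity.Theorems.SelfMixingDichotomyCoherentScaleExclusionSelfSimilarSwirlLoadFloor
import HarnessLib

/-!
# Route SelfMixingDichotomy — crux `SequentialTypeIExclusion` (S1, stmt-NavierStokesRegularity-1424), line `registered`,
# lead c6 (pulsating witness package): stub W4 `pulse_peakFloor`

Support file (`--supports stmt-NavierStokesRegularity-1424`) landing the registered stub `pulse_peakFloor` of the
pulsating kinematic witness package: the LOAD FLOOR of the pulsating self-similar swirling eddy

  `u t x = (a t · (1 − t)⁻¹ · expNegInvGlue (4 − ‖x‖²/(1 − t))) • (−x₁, x₀, 0)`   (`t < 1`; `0` after)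

at a PEAK scale `r > 0`: if the amplitude is constant, `a t = A ≥ 0`, on the time window
`t ∈ (1 − r²/4, 1 − r²/5)`, then `ofReal (κ A³) ≤ C(r; 1, 0) = cknC r (1, 0) u` with the universal
`κ = (1331/20000000) (expNegInvGlue 1)³ |B₁|`.

Proof: verbatim the sibling crux S2's `stub_selfSimilarSwirl_loadFloor`
(`…CoherentScaleExclusionSelfSimilarSwirlLoadFloor`). On that window and the ball `B((3r/5) e₀, r/20) ⊆ B(0, r)`
the slice at time `t` IS the constant-amplitude slice with `A := a t = A`, so
`selfSimilarSwirl_loadFloor_pointwise` gives the pointwise floor `m = A · (4/r²) · expNegInvGlue 1 · (11r/20)`, and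
`kinWitness_cknC_lowerBound_of_le_norm` (`…KinWitnessLoadLowerBound`) turns the product sub-box into
`C(r) ≥ ofReal ((b − a) s³ m³ / r²) |B₁| = ofReal (κ A³)` (scale free). Mathlib plus the landed sibling files only;
no definition, no named fact taken as a hypothesis.
-/

noncomputable section

open MeasureTheory Set Metric
open scoped ENNReal ContDiff
open Literature.Analysis.FluidPDE

set_option linter.dupNamespace false

namespace Summit.NavierStokesRegularity.NavierStokesRegularity.Theorems.SequentialTypeIExclusion.Registered

/-- Pointwise floor of the pulsating eddy on the peak sub-box: if `a t = A ≥ 0` on the window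
`t ∈ (1 − r²/4, 1 − r²/5)` (`r > 0`), then for such `t` and `x ∈ B((3r/5) e₀, r/20)`,
`A · (4/r²) · expNegInvGlue 1 · (11r/20) ≤ ‖u t x‖` (the slice is S2's constant-amplitude slice,
`selfSimilarSwirl_loadFloor_pointwise`). -/
theorem pulse_peakFloor_pointwise {a : ℝ → ℝ} {A r : ℝ} (hA : 0 ≤ A) (hr : 0 < r)
    (haA : ∀ t ∈ Set.Ioo (1 - r ^ 2 / 4) (1 - r ^ 2 / 5), a t = A) (t : ℝ)
    (ht : t ∈ Set.Ioo (1 - r ^ 2 / 4) (1 - r ^ 2 / 5)) (x : EuclideanSpace ℝ (Fin 3))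
    (hx : x ∈ Metric.ball (EuclideanSpace.single 0 (3 * r / 5) : EuclideanSpace ℝ (Fin 3)) (r / 20)) :
    A * (4 / r ^ 2) * expNegInvGlue 1 * (11 * r / 20) ≤
      ‖(fun (t : ℝ) (x : EuclideanSpace ℝ (Fin 3)) => if t < 1 then
          (a t * (1 - t)⁻¹ * expNegInvGlue (4 - ‖x‖ ^ 2 / (1 - t))) •
            (WithLp.toLp 2 ![-(x 1), x 0, 0] : EuclideanSpace ℝ (Fin 3)) else 0) t x‖ := by
  have h := selfSimilarSwirl_loadFloor_pointwise hA hr t ht x hx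
  dsimp only at h ⊢
  rw [haA t ht]
  exact h

/-- **W4 — load floor at a peak scale** (registered sub-goal `pulse_peakFloor` of the crux
`SequentialTypeIExclusion`, line `registered`, lead c6, pulsating witness package). There is a universal
`κ > 0` (`κ = (1331/20000000) (expNegInvGlue 1)³ |B₁|`) such that if `a = A ≥ 0` on the time window
`t ∈ (1 − r²/4, 1 − r²/5)`, then `ofReal (κ A³) ≤ C(r; 1, 0)`: on that window and the ball
`B((3r/5) e₀, r/20)` the speed is `≥ A (4/r²) expNegInvGlue 1 (11r/20)` (`pulse_peakFloor_pointwise`), then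
`kinWitness_cknC_lowerBound_of_le_norm`. -/
theorem pulse_peakFloor :
    ∃ κ : ℝ, 0 < κ ∧ ∀ (a : ℝ → ℝ) (A r : ℝ), 0 ≤ A → 0 < r →
      (∀ t ∈ Set.Ioo (1 - r ^ 2 / 4) (1 - r ^ 2 / 5), a t = A) →
      ENNReal.ofReal (κ * A ^ 3) ≤
        Literature.Analysis.FluidPDE.cknC r (((1 : ℝ), (0 : EuclideanSpace ℝ (Fin 3))) : ℝ × EuclideanSpace ℝ (Fin 3))
          (fun (t : ℝ) (x : EuclideanSpace ℝ (Fin 3)) => if t < 1 then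
            (a t * (1 - t)⁻¹ * expNegInvGlue (4 - ‖x‖ ^ 2 / (1 - t))) •
              (WithLp.toLp 2 ![-(x 1), x 0, 0] : EuclideanSpace ℝ (Fin 3)) else 0) := by
  -- the unit-ball volume `|B₁| ∈ (0, ∞)`
  have hvtop : volume (Metric.ball (0 : EuclideanSpace ℝ (Fin 3)) 1) ≠ ⊤ := measure_ball_lt_top.ne
  have hVpos : 0 < (volume (Metric.ball (0 : EuclideanSpace ℝ (Fin 3)) 1)).toReal :=
    ENNReal.toReal_pos (Metric.measure_ball_pos volume (0 : EuclideanSpace ℝ (Fin 3)) one_pos).ne' hvtop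
  have hg : 0 < expNegInvGlue 1 := expNegInvGlue.pos_of_pos one_pos
  refine ⟨1331 / 20000000 * expNegInvGlue 1 ^ 3 *
    (volume (Metric.ball (0 : EuclideanSpace ℝ (Fin 3)) 1)).toReal, by positivity, ?_⟩
  intro a A r hA hr haA
  have hr2 : 0 < r ^ 2 := pow_pos hr 2
  have hm : 0 ≤ A * (4 / r ^ 2) * expNegInvGlue 1 * (11 * r / 20) :=
    mul_nonneg (mul_nonneg (mul_nonneg hA (by positivity)) hg.le) (by positivity)
  -- `B((3r/5) e₀, r/20) ⊆ B(0, r)`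
  have hball : Metric.ball (EuclideanSpace.single 0 (3 * r / 5) : EuclideanSpace ℝ (Fin 3)) (r / 20) ⊆
      Metric.ball (0 : EuclideanSpace ℝ (Fin 3)) r := by
    intro x hx
    rw [Metric.mem_ball, dist_zero_right]
    have := (selfSimilarSwirl_loadFloor_ball hr x hx).1
    linarith
  -- the generic lower bound on the product sub-region
  have hC := kinWitness_cknC_lowerBound_of_le_norm
    (fun (t : ℝ) (x : EuclideanSpace ℝ (Fin 3)) => if t < 1 then
      (a t * (1 - t)⁻¹ * expNegInvGlue (4 - ‖x‖ ^ 2 / (1 - t))) •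
        (WithLp.toLp 2 ![-(x 1), x 0, 0] : EuclideanSpace ℝ (Fin 3)) else 0)
    1 0 r hr (1 - r ^ 2 / 4) (1 - r ^ 2 / 5) (r / 20) (A * (4 / r ^ 2) * expNegInvGlue 1 * (11 * r / 20))
    (EuclideanSpace.single 0 (3 * r / 5)) (by linarith) (by linarith) (by linarith) (by positivity) hm
    hball (fun t ht x hx => pulse_peakFloor_pointwise hA hr haA t ht x hx)
  refine le_trans (le_of_eq ?_) hC
  -- `κ A³ = ((b - a) s³ m³ / r²) |B₁|`, scale free
  have hnonneg : 0 ≤ (1 - r ^ 2 / 5 - (1 - r ^ 2 / 4)) * (r / 20) ^ 3 *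
      (A * (4 / r ^ 2) * expNegInvGlue 1 * (11 * r / 20)) ^ 3 / r ^ 2 := by
    have hba : 0 < 1 - r ^ 2 / 5 - (1 - r ^ 2 / 4) := by linarith
    positivity
  have hkey : 1331 / 20000000 * expNegInvGlue 1 ^ 3 *
        (volume (Metric.ball (0 : EuclideanSpace ℝ (Fin 3)) 1)).toReal * A ^ 3 =
      (1 - r ^ 2 / 5 - (1 - r ^ 2 / 4)) * (r / 20) ^ 3 *
        (A * (4 / r ^ 2) * expNegInvGlue 1 * (11 * r / 20)) ^ 3 / r ^ 2 *
        (volume (Metric.ball (0 : EuclideanSpace ℝ (Fin 3)) 1)).toReal := by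
    field_simp
    ring
  rw [hkey, ENNReal.ofReal_mul hnonneg, ENNReal.ofReal_toReal hvtop]

end Summit.NavierStokesRegularity.NavierStokesRegularity.Theorems.SequentialTypeIExclusion.Registered

end
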